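/-
Copyright: cell pub-balaban-gaps (YM BLITZ Y1, track G1), seat g1-p2 GEN 4 (unit `pub-balaban-gaps-g1-p2`).  Row (D4) NODE O,
OBJECT ∕ MECHANISM level: the BLOCK currency one level above `JointWalkExpansion` (repair of the located limit RESIDUE (D4) v1.11 V47 =
g1-plan-1 N21-1 ∕ N22-1 ∕ X24-1): print's (3.108) bounds are ℓ^∞→ℓ^∞ OPERATOR norms between M-cubes, whose products cost a CUBE count and
NO fibre factor; here: the block norm of a complex matrix between two cubes, its entry bound, its SUBMULTIPLICATIVITY over cubes, the
`BlockWalkExpansion` shape and its read-off to the NODE-O object.  HONEST FRAMING: elementary; nothing of Bałaban's constructed or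
asserted; (D4) NOT discharged (instance 0∕1); NOT BetaPertH, NOT continuum, NOT Clay.
-/
import Literature.MathematicalPhysics.QuantumFieldTheory.Balaban1983to89.B13JointWalkExpansion

/-!
# `Gaps.D4WalkBlock` — block (cube-to-cube operator) norms for the NODE-O walk calculus: entry bound, submultiplicativity WITHOUT
# fibre factor, and the read-off `BlockWalkExpansion → JointWalkExpansion` (cell pub-balaban-gaps, seat g1-p2 gen 4)

HONEST DEPENDENCY (cell pub-balaban, verbatim): continuum YM on T⁴ ⇐ BetaPertH ∧ nine spine estimates (0/9 proved);
BetaPertH ⇐ (D1) ∧ (D4) ∧ CAP+tail.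

[B9] Thm 3.10 (3.108) p. 416 bounds a walk term as an OPERATOR between blocks: *"|(R₀(X₀)R_{α₁}(X₁)·…·R_{αₙ}(Xₙ)J)(x)| ≤ … |J|,
x ∈ Δ(y), y ∈ Λ_j, supp J ⊂ Δ(y′)"* — an ℓ^∞ → ℓ^∞ bound from the block of `y′` to the block of `y`; products of such bounds sum over
the intermediate BLOCK ((3.92)–(3.94) p. 410, Lemma 2.1 (2.61) at the cube scale), never over the sites inside it.  The tree's
entry-level product (`Spine/NE5/ProductWalks.norm_mul_entry_le_of_walks`) instead pays a per-site fibre `m` and a site row sum, which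
at print's rates is a small-coupling regime (RESIDUE (D4) v1.11 V47).  THIS FILE supplies the block currency for complex matrices
indexed by located rows ∕ columns: `rowMass`, `blockNorm` (sup over the rows in cube `y` of the ℓ¹-mass of the row inside cube
`y′`), `norm_entry_le_blockNorm`, `blockNorm_mul_le` (`‖SR‖_{y,y′} ≤ Σ_{y″} ‖S‖_{y,y″}‖R‖_{y″,y′}` — NO fibre factor), the shape
`BlockWalkExpansion` (= `JointWalkExpansion` with the per-term ENTRY bound replaced by the per-term BLOCK bound) and
`BlockWalkExpansion.toJoint` (read-off; locators = cube maps).  The product ∕ Neumann steps in this currency and the domain-local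
base objects with operator-norm letters are the next files (design: `HOME/pub-balaban-gaps-g1-p2/g4/BLOCKNORM-ADAPTER.md`).
Value: elementary bookkeeping; nothing of Bałaban's asserted; words of row (D4) UNCHANGED.
-/

noncomputable section

namespace Summit.QuantumFields.BalabanUV.Gaps.D4WalkBlock

open Metric Set Finset
open Literature.MathematicalPhysics.QuantumFieldTheory.Balaban1983to89
open Literature.MathematicalPhysics.QuantumFieldTheory.Balaban1983to89.B9SectDWalk (Through MajSumLe)
open Literature.MathematicalPhysics.QuantumFieldTheory.Balaban1983to89.B9Thm34Ext (toB6)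
open Literature.MathematicalPhysics.QuantumFieldTheory.Balaban1983to89.B9Thm37GlueTorus (torusGeom tdist1)
open Literature.MathematicalPhysics.QuantumFieldTheory.Balaban1983to89.TreeLengthTorus (TPt)
open Literature.MathematicalPhysics.QuantumFieldTheory.Balaban1983to89.B5TorusCover (UT)
open Literature.MathematicalPhysics.QuantumFieldTheory.Balaban1983to89.B13JointWalkExpansion (JointWalkExpansion)

/-! ## §1. The block norm of a complex matrix between two cubes -/

section BlockNorm

variable {ν : ℕ} {K : Fin ν → ℕ}
variable {p n q : Type} [Fintype p] [Fintype n] [Fintype q]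

/-- The ℓ¹-mass of row `i` inside the column cube `y′`: `Σ_{j : cub j = y′} ‖T i j‖`. -/
def rowMass (cubn : n → UT K) (T : Matrix p n ℂ) (i : p) (y' : UT K) : ℝ :=
  ∑ j ∈ Finset.univ.filter (fun j => cubn j = y'), ‖T i j‖

/-- **The block norm** `‖T‖_{y,y′}`: the ℓ^∞ → ℓ^∞ operator norm of the `(y, y′)` block — the sup over the rows `i` in cube `y` of the
row mass inside cube `y′` (`0` on an empty row cube). -/
def blockNorm (cub : p → UT K) (cubn : n → UT K) (T : Matrix p n ℂ) (y y' : UT K) : ℝ :=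
  if h : (Finset.univ.filter (fun i => cub i = y)).Nonempty then
    (Finset.univ.filter (fun i => cub i = y)).sup' h (fun i => rowMass cubn T i y') else 0

variable (cub : p → UT K) (cubn : n → UT K) (cubq : q → UT K)

omit [Fintype p] in
/-- Row masses are non-negative. -/
theorem rowMass_nonneg (T : Matrix p n ℂ) (i : p) (y' : UT K) : 0 ≤ rowMass cubn T i y' :=
  Finset.sum_nonneg fun _ _ => norm_nonneg _

/-- Block norms are non-negative. -/
theorem blockNorm_nonneg (T : Matrix p n ℂ) (y y' : UT K) : 0 ≤ blockNorm cub cubn T y y' := by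
  unfold blockNorm
  split_ifs with h
  · obtain ⟨i, hi⟩ := h
    exact (rowMass_nonneg cubn T i y').trans (Finset.le_sup' (fun i => rowMass cubn T i y') hi)
  · exact le_rfl

/-- A row mass is below the block norm of its cube pair. -/
theorem rowMass_le_blockNorm (T : Matrix p n ℂ) (i : p) (y' : UT K) :
    rowMass cubn T i y' ≤ blockNorm cub cubn T (cub i) y' := by
  have hi : i ∈ Finset.univ.filter (fun i' => cub i' = cub i) := by simp
  unfold blockNorm
  rw [dif_pos ⟨i, hi⟩]
  exact Finset.le_sup' (fun i' => rowMass cubn T i' y') hi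

/-- **Entry bound**: `‖T i j‖ ≤ ‖T‖_{cub i, cub j}` (the read-off used by `BlockWalkExpansion.toJoint`). -/
theorem norm_entry_le_blockNorm (T : Matrix p n ℂ) (i : p) (j : n) : ‖T i j‖ ≤ blockNorm cub cubn T (cub i) (cubn j) := by
  have hj : j ∈ Finset.univ.filter (fun j' => cubn j' = cubn j) := by simp
  exact (Finset.single_le_sum (f := fun j' => ‖T i j'‖) (fun _ _ => norm_nonneg _) hj).trans
    (rowMass_le_blockNorm cub cubn T i (cubn j))

/-- The block norm is below any uniform bound of the row masses of its row cube. -/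
theorem blockNorm_le_of_rowMass_le (T : Matrix p n ℂ) (y y' : UT K) {B : ℝ} (hB : 0 ≤ B)
    (h : ∀ i, cub i = y → rowMass cubn T i y' ≤ B) : blockNorm cub cubn T y y' ≤ B := by
  unfold blockNorm
  split_ifs with hne
  · exact Finset.sup'_le _ _ fun i hi => h i (Finset.mem_filter.1 hi).2
  · exact hB

/-- **SUBMULTIPLICATIVITY OVER CUBES — NO FIBRE FACTOR**: `‖S·R‖_{y,y′} ≤ Σ_{y″} ‖S‖_{y,y″}·‖R‖_{y″,y′}` (the inner index sum is
absorbed in the ℓ¹ row mass of `S` and the sup of `R`; print's (3.92)→(3.94) count). -/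
theorem blockNorm_mul_le (S : Matrix p n ℂ) (R : Matrix n q ℂ) (y y' : UT K) :
    blockNorm cub cubq (S * R) y y' ≤ ∑ y'' : UT K, blockNorm cub cubn S y y'' * blockNorm cubn cubq R y'' y' := by
  classical
  refine blockNorm_le_of_rowMass_le cub cubq (S * R) y y'
    (Finset.sum_nonneg fun y'' _ => mul_nonneg (blockNorm_nonneg cub cubn S y y'') (blockNorm_nonneg cubn cubq R y'' y'))
    fun i hi => ?_
  -- rowMass (S R) i y′ ≤ Σ_k ‖S i k‖ · rowMass R k y′
  have h1 : rowMass cubq (S * R) i y' ≤ ∑ k, ‖S i k‖ * rowMass cubq R k y' := by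
    unfold rowMass
    calc ∑ j ∈ Finset.univ.filter (fun j => cubq j = y'), ‖(S * R) i j‖
        ≤ ∑ j ∈ Finset.univ.filter (fun j => cubq j = y'), ∑ k, ‖S i k‖ * ‖R k j‖ :=
          Finset.sum_le_sum fun j _ => by
            rw [Matrix.mul_apply]
            exact (norm_sum_le _ _).trans (le_of_eq (Finset.sum_congr rfl fun k _ => norm_mul _ _))
      _ = ∑ k, ‖S i k‖ * ∑ j ∈ Finset.univ.filter (fun j => cubq j = y'), ‖R k j‖ := by
          rw [Finset.sum_comm]; exact Finset.sum_congr rfl fun k _ => by rw [Finset.mul_sum]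
  -- … ≤ Σ_k ‖S i k‖ · ‖R‖_{cub k, y′} = Σ_{y″} (Σ_{k ∈ y″} ‖S i k‖) · ‖R‖_{y″,y′} = Σ_{y″} rowMass S i y″ · ‖R‖_{y″,y′}
  have h2 : ∑ k, ‖S i k‖ * rowMass cubq R k y' ≤ ∑ k, ‖S i k‖ * blockNorm cubn cubq R (cubn k) y' :=
    Finset.sum_le_sum fun k _ => mul_le_mul_of_nonneg_left (rowMass_le_blockNorm cubn cubq R k y') (norm_nonneg _)
  have h3 : ∑ k, ‖S i k‖ * blockNorm cubn cubq R (cubn k) y' =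
      ∑ y'' : UT K, rowMass cubn S i y'' * blockNorm cubn cubq R y'' y' := by
    rw [← Finset.sum_fiberwise_of_maps_to (g := cubn) (t := Finset.univ) (fun k _ => Finset.mem_univ _)]
    refine Finset.sum_congr rfl fun y'' _ => ?_
    rw [rowMass, Finset.sum_mul]
    exact Finset.sum_congr rfl fun k hk => by rw [(Finset.mem_filter.1 hk).2]
  have h4 : ∑ y'' : UT K, rowMass cubn S i y'' * blockNorm cubn cubq R y'' y' ≤
      ∑ y'' : UT K, blockNorm cub cubn S y y'' * blockNorm cubn cubq R y'' y' :=
    Finset.sum_le_sum fun y'' _ => mul_le_mul_of_nonneg_right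
      (by rw [← hi]; exact rowMass_le_blockNorm cub cubn S i y'') (blockNorm_nonneg cubn cubq R y'' y')
  exact h1.trans (h2.trans (h3.le.trans h4))

/-- **Subadditivity**: `‖S + T‖_{y,y′} ≤ ‖S‖_{y,y′} + ‖T‖_{y,y′}`. -/
theorem blockNorm_add_le (S T : Matrix p n ℂ) (y y' : UT K) :
    blockNorm cub cubn (S + T) y y' ≤ blockNorm cub cubn S y y' + blockNorm cub cubn T y y' := by
  refine blockNorm_le_of_rowMass_le cub cubn (S + T) y y'
    (add_nonneg (blockNorm_nonneg cub cubn S y y') (blockNorm_nonneg cub cubn T y y')) fun i hi => ?_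
  have h1 : rowMass cubn (S + T) i y' ≤ rowMass cubn S i y' + rowMass cubn T i y' := by
    unfold rowMass
    rw [← Finset.sum_add_distrib]
    exact Finset.sum_le_sum fun j _ => by rw [Matrix.add_apply]; exact norm_add_le _ _
  rw [← hi]
  exact h1.trans (add_le_add (rowMass_le_blockNorm cub cubn S i y') (rowMass_le_blockNorm cub cubn T i y'))

/-- **Homogeneity bound**: `‖t • T‖_{y,y′} ≤ ‖t‖·‖T‖_{y,y′}`. -/
theorem blockNorm_smul_le (t : ℂ) (T : Matrix p n ℂ) (y y' : UT K) :
    blockNorm cub cubn (t • T) y y' ≤ ‖t‖ * blockNorm cub cubn T y y' := by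
  refine blockNorm_le_of_rowMass_le cub cubn (t • T) y y' (mul_nonneg (norm_nonneg t) (blockNorm_nonneg cub cubn T y y'))
    fun i hi => ?_
  have e : rowMass cubn (t • T) i y' = ‖t‖ * rowMass cubn T i y' := by
    simp only [rowMass, Matrix.smul_apply, smul_eq_mul, norm_mul, Finset.mul_sum]
  rw [e, ← hi]
  exact mul_le_mul_of_nonneg_left (rowMass_le_blockNorm cub cubn T i y') (norm_nonneg t)

/-- **The identity's blocks**: `‖1‖_{y,y′} ≤ [y = y′]` (diagonal blocks have operator norm `≤ 1`, off-diagonal blocks vanish). -/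
theorem blockNorm_one_le [DecidableEq n] (cubn' : n → UT K) (y y' : UT K) :
    blockNorm cubn' cubn' (1 : Matrix n n ℂ) y y' ≤ if y = y' then 1 else 0 := by
  refine blockNorm_le_of_rowMass_le cubn' cubn' 1 y y' (by split_ifs <;> norm_num) fun i hi => ?_
  have e : rowMass cubn' (1 : Matrix n n ℂ) i y' = if cubn' i = y' then 1 else 0 := by
    unfold rowMass
    have h1 : ∀ j, ‖(1 : Matrix n n ℂ) i j‖ = if i = j then (1 : ℝ) else 0 := fun j => by
      rw [Matrix.one_apply]; split_ifs <;> simp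
    simp only [h1, Finset.sum_ite_eq, Finset.mem_filter, Finset.mem_univ, true_and]
  rw [e, hi]

end BlockNorm

/-! ## §2. The block walk-expansion shape and its read-off to the NODE-O object -/

section Shape

variable {d N' : ℕ} {ν : ℕ} {K : Fin ν → ℕ} [∀ i, NeZero (K i)]
variable {p n : Type} [Fintype p] [Fintype n]
variable {E : Type*} [NormedAddCommGroup E] [NormedSpace ℂ E]

/-- **BLOCK WALK EXPANSION** of a kernel family on the CUBE torus `UT K` (named hypothesis shape): `B13JointWalkExpansion.JointWalkExpansion`
with rows ∕ columns located by their CUBE maps `cub`, `cubn` and the per-term ENTRY bound replaced by the per-term BLOCK bound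
`‖T_ω(σ,u)‖_{y,y′} ≤ A_ω e^{−ρD_ω(y,y′)}` — print's (3.108) currency.  All other fields as in the NODE-O object (hasSum ∕ termAnalytic
entrywise; majSum over the cube geometry `toB6 (torusGeom K 0 0 0) 0 True`; σ-structure). [cite: Balaban1985BackgroundPropagators, Thm 3.10 (3.107)–(3.108) p.416; Balaban1988RG2Cluster, (1.11) p.5, p.13, p.15] -/
structure BlockWalkExpansion (c : B13.Consts) (cub : p → UT K) (cubn : n → UT K)
    (K2 : (TPt d N' → ℂ) → E → Matrix p n ℂ) (X : Finset (UT K)) (R ε kap Kbar : ℝ)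
    {W : Type} (T2 : W → (TPt d N' → ℂ) → E → Matrix p n ℂ) (SX : Set W) (A : W → ℝ)
    (D : W → UT K → UT K → ℝ) (ρ : ℝ) : Prop where
  hasSum : ∀ σ : TPt d N' → ℂ, (∀ j, ‖σ j‖ ≤ Real.exp c.κ₁) → ∀ u ∈ ball (0 : E) R,
    ∀ i j, HasSum (fun ω => T2 ω σ u i j) (K2 σ u i j)
  termAnalytic : ∀ ω, ∀ σ : TPt d N' → ℂ, (∀ j, ‖σ j‖ ≤ Real.exp c.κ₁) →
    ∀ i j, DifferentiableOn ℂ (fun u => T2 ω σ u i j) (ball (0 : E) R)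
  majB : ∀ ω, ∀ σ : TPt d N' → ℂ, (∀ j, ‖σ j‖ ≤ Real.exp c.κ₁) → ∀ u ∈ ball (0 : E) R,
    ∀ y y', blockNorm cub cubn (T2 ω σ u) y y' ≤ A ω * Real.exp (-(ρ * D ω y y'))
  majSum : MajSumLe (g := toB6 (torusGeom K 0 0 0) 0 True)
    (fun ω a b => A ω * Real.exp (-((ρ - ε) * D ω a b))) (fun a b => Kbar * Real.exp (-(kap * tdist1 K a b)))
  indep : ∀ ω, ω ∉ SX → ∀ σ : TPt d N' → ℂ, (∀ j, ‖σ j‖ ≤ Real.exp c.κ₁) → T2 ω σ 0 = T2 ω 0 0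
  through : ∀ ω ∈ SX, Through (toB6 (torusGeom K 0 0 0) 0 True) (D ω) (↑X : Set (UT K))
  A_nonneg : ∀ ω, 0 ≤ A ω
  D_nonneg : ∀ ω a b, 0 ≤ D ω a b

variable {c : B13.Consts} {cub : p → UT K} {cubn : n → UT K} {K2 : (TPt d N' → ℂ) → E → Matrix p n ℂ}
variable {X : Finset (UT K)} {R ε kap Kbar : ℝ}
variable {W : Type} {T2 : W → (TPt d N' → ℂ) → E → Matrix p n ℂ} {SX : Set W} {A : W → ℝ}
variable {D : W → UT K → UT K → ℝ} {ρ : ℝ}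

/-- **READ-OFF**: a block walk expansion IS a joint walk expansion of the NODE-O object with locators the cube maps (entries are
below block norms), so every downstream consumer (`TermWalkData`, `differences216_of_termWalkData`, Lemma 3) applies on the cube torus.
[cite: Balaban1985BackgroundPropagators, (3.108) p.416; Balaban1988RG2Cluster, p.13, p.15] -/
theorem BlockWalkExpansion.toJoint (h : BlockWalkExpansion c cub cubn K2 X R ε kap Kbar T2 SX A D ρ) :
    JointWalkExpansion c cub cubn K2 X R ε kap Kbar T2 SX A D ρ where
  hasSum := h.hasSum
  termAnalytic := h.termAnalytic
  maj ω σ hσ u hu i j := (norm_entry_le_blockNorm cub cubn (T2 ω σ u) i j).trans (h.majB ω σ hσ u hu (cub i) (cubn j))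
  majSum := h.majSum
  indep := h.indep
  through := h.through
  A_nonneg := h.A_nonneg
  D_nonneg := h.D_nonneg

end Shape

end Summit.QuantumFields.BalabanUV.Gaps.D4WalkBlock

end
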